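import Summits.HodgeConjecture.HodgeConjecture.Theses.EightfoldBlochSeeds
import Literature.AlgebraicGeometry.HodgeTheory.WeilClassesFourfoldsProofs
import Literature.AlgebraicGeometry.Motives.AbelianVarietyProductDimProofs
import Literature.AlgebraicGeometry.Motives.AimedSplitProductDischarge
import Literature.NumberTheory.EllipticCurves.CMEndomorphismOfMulMemLattice
import HarnessLib
import HarnessLib.Audit

/-!
# Line `birth` (BC3/BC5 skeleton) — crux `EightfoldBlochSeeds.BlochSeedDiscOne`
# (item stmt-HodgeConjecture-18881, route route-HodgeConjecture-EightfoldBlochSeeds rev 3, FRONTIER) — v1 (bc5-witness planner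
# `hodge-bloch-bc5-plan` g0, 2026-08-26)

Crux (VERBATIM the route decl, concluded BY NAME below): `BlochSeedDiscOne := HasHyperbolicBlochSeed 4 1` — some complex
abelian EIGHTFOLD `P` with `ψ₀ ≫ ψ₀ = -1`, HYPERBOLIC for the `K`-symmetrised hyperplane class `h_K = ι^*a + ψ₀^*ι^*a` of a
projective embedding, a non-zero rational class `w` of its `ℚ(i)`-Weil plane, and a BLOCH SEED for `q·h_K⁴ + w`: an
integral closed subscheme `Z ⊂ P`, a regular immersion of codimension `4`, Bloch-semiregular (`IsBlochSemiregular i 8 4`),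
with `q·h_K⁴ + w` supported on `Z` (`HasBlochSeedAt 4 P h_K w`).

## Why-clause (tribunal T3 / planner BC5): n = 4 EIGHTFOLDS; HC / Weil-class algebraicity is OPEN there (the summit leaf
`WeilSixfolds` speaks of sixfolds; in print only fourfolds — Markman 2025, all `d` — and the special CM / product members are
known); LEVER = a Bloch seed with NON-ZERO Weil part (`IsBlochSemiregular ∧ w ≠ 0`, both clauses kept in every stub below).

## The line: PAD-4 zero-locus seeds ON THE NAMED PRODUCT ANCHOR `S⁴`, `S = E_i × E_{-i}`

THE ANCHOR (named, constructed here over tree declarations): for a complex elliptic curve `E₀` (`E₀.dim = 1`) with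
`ψ₀ ≫ ψ₀ = -1` (`ψ₀ = [i]`; exists: `exists_cmCurve_sqrt_neg 1`), the Weil surface `S := E₀ × E₀` with `φ_S := ψ₀ × (-ψ₀)`
(the tree's `exists_weilType_cmSquare`) and the eightfold `pad4Anchor E₀ := ((S × S) × S) × S` with the product action
`pad4Action E₀ ψ₀` (`prodLift (fst ≫ ·) (snd ≫ φ_S)` three times — the shape consumed by `aimedSplitProduct_cmSquare_of_pos`).
PROVED here: `dim = 2·4` (`dim_prod`) and `pad4Action ≫ pad4Action = -1` (`prodLift_comp_self_eq_neg_nsmul`).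

REGISTERED STUBS (sorried; `propose --supports stmt-HodgeConjecture-18881` proving one BY NAME + SIGNATURE is the fleet mode):
* `stub_rung_pad4_seedAt` — **THE RUNG (BC5 / T3, PLAN-ONLY) and THE BET**: on `pad4Anchor E₀` (every CM curve `(E₀, ψ₀)`,
  `ψ₀² = -1` — they are all isomorphic to `E_i`) there are a projective embedding `e`, a rational hyperplane class `a ≠ 0`
  with `(pad4Anchor, pad4Action)` HYPERBOLIC for `h_K(e, a)`, a NON-ZERO RATIONAL class `w` OF THE `ℚ(i)`-WEIL PLANE
  `weilClassesOf _ _ 4 1`, and a Bloch seed `HasBlochSeedAt 4 (pad4Anchor E₀) h_K w`.  = the crux PINNED to the named CM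
  anchor (strictly stronger than the crux: `BlochSeedDiscOne_of_pad4` below; not equivalent — a seed on another eightfold
  does not give one here).  NAMED TECHNIQUE: a PAD-4 two-level ⊕-block design `0 → 𝓔 → ⊕_{i≤7} L_i → ⊕_{j≤3} M_j → 0` of
  Néron–Severi line bundles on `S⁴` of shape `(7,3)` (the first shape passing the e-word identity
  `Σ_i ε_i ∏_f (1 + 2 Re(β_{i,f} t_f)) = 4 + 2 Re(μ t₀t₁t₂t₃)`, `μ ∈ ℚ(i)ˣ` — gs-eng-2 XCHECK-LI2-ORDER4 v1.5 §9/§11, every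
  `k ≤ 6` shape is class-dead), made RATIONAL and POSITIVE (s4-search-1 g18 `pad4/`), whence a regular section `s`
  (Mumford, Abelian Varieties §16–17; Fulton, Intersection Theory Ex. 14.1.1: `[Z(s)] = c₄(𝓔) = q·h⁴ + w_μ`), `Z(s)` lci of
  codimension 4 (Fulton Ex. 6.3.4 (a)), integral (Fulton–Lazarsfeld connectedness for ample bundles of rank `4 < 8`, plus
  generic smoothness where the design is globally generated — part of the bet for kernel-type designs), and
  BLOCH-SEMIREGULAR by a certified `σ`-injectivity computation for the named design (engine-w-1 `s4tan_A.py` v2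
  e625920ce4503091: first order along `T_P(Weil locus) ≅ M₄(ℂ)`, then the full Bloch map `H¹(N_Z) → H⁵(Ω³_P)` via the Koszul
  resolution), typed through the consumer `HasBlochSeedAt` (ZL4C-SCOPING v0.2).  `h_K(e, a) = 6·h_std` for the embedding by
  `3·h_std` (`h_std = Σ_f t_f` is `ψ`-invariant), hyperbolic since `⊕` of four hyperbolic `ℚ(i)`-planes.
  WHY IT MIGHT FAIL: no `(7,3)` design has yet passed rationality + positivity; every divisor-generated / two-slope / `k ≤ 6`
  design has Weil part `0` (LAW CD, CE₃/CE₄ theorem), and for charged designs the Bloch map `H¹(N_Z) → H⁵(Ω³_P)` (target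
  of dimension `56² = 3136`) may acquire kernel from deformations of `Z` leaving the Weil locus (census N4-TABLE-1);
  Bloch-semiregularity of zero loci with charged `c₄` is untested at `n = 4`.
* `stub_pad4_carrier` — SUB-RUNG (the `(A1)` half, strictly weaker, first idle-prover target): the same data WITHOUT the
  semiregularity clause and without hyperbolicity — an integral lci fourfold `Z ⊂ pad4Anchor E₀` carrying `q·h_K⁴ + w`,
  `w ≠ 0` rational in the Weil plane (`HasLciCarrierAt`, this file).  PROVED: `stub_rung_pad4_seedAt → stub_pad4_carrier`
  statementwise (`hasLciCarrierAt_of_hasBlochSeedAt`, `pad4_carrier_of_seedAt`).  OPEN on its own: every carrier built so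
  far (complete intersections, LI-1/LI-2 linked residuals, semi-homogeneous and box designs) has Weil part `0`
  (gs-eng-2 RESULTS 3 + 5: CE₃/CE₄ whenever one class is nef ≠ 0; THEOREM SH; LEMMA COMM/FQ).  HC at the CM anchor
  (powers of a CM elliptic curve) plus Kleiman's smoothing theorem (`CH_i^{sm} = CH_i ⊗ ℚ` for `i < (dim + 2)/2`, here
  `4 < 5`; Vezzosi et al., arXiv:1612.04570 §1.1, Cor. 1.6) only write `q·h⁴ + w` as a SIGNED `ℚ`-combination of classes of
  smooth subvarieties / of top Chern classes — not as the class line of ONE integral lci `Z`, which is what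
  `classesSupportedOn` (purity) demands.  NOT a T3 witness by itself (J grid (3b): no semiregularity clause) — a stepping
  stone only.

COMPOSITION (kernel-checked, no sorry outside the stubs): `BlochSeedDiscOne_of_pad4 : BlochSeedDiscOne` :=
`exists_cmCurve_sqrt_neg 1` ▸ `pad4Anchor_dim` ▸ `pad4Action_comp_self` ▸ `stub_rung_pad4_seedAt`.

## Disproof / negatives used
No `Cruxes/BlochSeedDiscOne/Disproof.lean` exists (crux dir empty at 2026-08-26T13:00Z).  Negatives honoured: LI-2-as-SEED
DEAD OUTRIGHT (census v2.8g: CE₃/CE₄ theorem ×2 + (2.LI-2-SR-b)) — no stub is LI-2-shaped; `schoenCycle_not_blochSemiregular`,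
`SemiregularityEulerFormBarrier`, the n = 2 window `BlochSeedRankTwoWindow` (fourfolds = known regime, J grid (3a)) — the
rung lives at n = 4 with `w ≠ 0` explicit (J grid (3b)).

## References
[cite: Bloch1972Semiregularity, Thm. (7.4) and Remark (7.5)] [cite: BuchweitzFlenner2003, Thm. 5.2 and (8.1)]
[cite: Markman2025SecantWeil, §1.5] [cite: vanGeemen1994HodgeAV, 5.3–5.5] [cite: Schoen1998HodgeWeilAddendum, §10]
[cite: Fulton1998IntersectionTheory, Prop. 14.1 (a),(c), Ex. 14.1.1, Ex. 6.3.4 (a)] [cite: MumfordAV1970, §16]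
[cite: arXiv:1612.04570, §1.1 (Kleiman's range) and Cor. 1.6]
-/

noncomputable section

-- single-problem summit (Problem = Summit): the mandated namespace repeats `HodgeConjecture`.
set_option linter.dupNamespace false

open CategoryTheory AlgebraicGeometry
open Literature.AlgebraicGeometry Literature.AlgebraicGeometry.Motives Literature.AlgebraicGeometry.HodgeTheory
open Literature.AlgebraicTopology.SingularHomology

namespace Summit.HodgeConjecture.HodgeConjecture.Cruxes.BlochSeedDiscOne.Birth

universe u

/-! ## §0 The named anchor `S⁴`, `S = E₀ × E₀`, `φ_S = ψ₀ × (-ψ₀)` -/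

section Anchor

variable (E₀ : AbelianVariety ℂ) (ψ₀ : E₀ ⟶ E₀)

/-- The Weil surface `S = E₀ × E₀`. -/
abbrev weilSurf : AbelianVariety ℂ := E₀.prod E₀

/-- Its Weil action `φ_S = ψ₀ × (-ψ₀)` (the tree's `exists_weilType_cmSquare`). -/
abbrev weilSurfAct : weilSurf E₀ ⟶ weilSurf E₀ :=
  AbelianVariety.prodLift (AbelianVariety.fst E₀ E₀ ≫ ψ₀) (AbelianVariety.snd E₀ E₀ ≫ (-ψ₀))

/-- `S²  = S × S`. -/
abbrev pad2Anchor : AbelianVariety ℂ := (weilSurf E₀).prod (weilSurf E₀)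
/-- `S³ = S² × S`. -/
abbrev pad3Anchor : AbelianVariety ℂ := (pad2Anchor E₀).prod (weilSurf E₀)
/-- **The PAD-4 anchor** `S⁴ = S³ × S` (as a complex torus `≅ E₀⁸`; the Weil structure is `(i,-i)⁴`). -/
abbrev pad4Anchor : AbelianVariety ℂ := (pad3Anchor E₀).prod (weilSurf E₀)

/-- Product action on `S²`. -/
abbrev pad2Action : pad2Anchor E₀ ⟶ pad2Anchor E₀ :=
  AbelianVariety.prodLift (AbelianVariety.fst _ _ ≫ weilSurfAct E₀ ψ₀) (AbelianVariety.snd _ _ ≫ weilSurfAct E₀ ψ₀)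
/-- Product action on `S³`. -/
abbrev pad3Action : pad3Anchor E₀ ⟶ pad3Anchor E₀ :=
  AbelianVariety.prodLift (AbelianVariety.fst _ _ ≫ pad2Action E₀ ψ₀) (AbelianVariety.snd _ _ ≫ weilSurfAct E₀ ψ₀)
/-- **The PAD-4 action** `ψ = φ_S × φ_S × φ_S × φ_S` on `S⁴`, in the nested shape `prodLift (fst ≫ ·) (snd ≫ φ_S)` that
`aimedSplitProduct_cmSquare_of_pos` consumes. -/
abbrev pad4Action : pad4Anchor E₀ ⟶ pad4Anchor E₀ :=
  AbelianVariety.prodLift (AbelianVariety.fst _ _ ≫ pad3Action E₀ ψ₀) (AbelianVariety.snd _ _ ≫ weilSurfAct E₀ ψ₀)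

/-- The `K`-symmetrised hyperplane class `h_K(e, a) = 1·ι^*a + ψ^*ι^*a` at `d = 1` (the literal shape inside
`HasHyperbolicBlochSeed 4 1`). -/
abbrev symH {P : AbelianVariety ℂ} (ψ : P ⟶ P) (e : ProjectiveEmbedding P.X)
    (a : complexBetti (projectiveSpace e.n ℂ) 2) : complexBetti P.X 2 :=
  ((1 : ℕ) : ℂ) • complexBetti.map e.ι 2 a + complexBetti.map ψ.hom.hom.hom 2 (complexBetti.map e.ι 2 a)

variable {E₀ ψ₀}

/-- `dim S = 2·1`. -/
theorem weilSurf_dim (hE : E₀.dim = 1) : (weilSurf E₀).dim = 2 * 1 := by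
  show (E₀.prod E₀).dim = 2 * 1
  rw [AbelianVariety.dim_prod, hE]

/-- `dim S⁴ = 2·4`. -/
theorem pad4Anchor_dim (hE : E₀.dim = 1) : (pad4Anchor E₀).dim = 2 * 4 := by
  have h1 := weilSurf_dim hE
  have h2 : (pad2Anchor E₀).dim = 2 * (1 + 1) := dim_prod_eq_two_mul h1 h1
  have h3 : (pad3Anchor E₀).dim = 2 * ((1 + 1) + 1) := dim_prod_eq_two_mul h2 h1
  have h4 : (pad4Anchor E₀).dim = 2 * (((1 + 1) + 1) + 1) := dim_prod_eq_two_mul h3 h1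
  simpa using h4

/-- `(-ψ₀)² = ψ₀²`. -/
theorem neg_comp_neg_eq (hψ : ψ₀ ≫ ψ₀ = -(1 • 𝟙 E₀)) : (-ψ₀) ≫ (-ψ₀) = -(1 • 𝟙 E₀) := by
  rw [Preadditive.neg_comp_neg]; exact hψ

/-- `φ_S ≫ φ_S = -1`. -/
theorem weilSurfAct_comp_self (hψ : ψ₀ ≫ ψ₀ = -(1 • 𝟙 E₀)) :
    weilSurfAct E₀ ψ₀ ≫ weilSurfAct E₀ ψ₀ = -(1 • 𝟙 (weilSurf E₀)) :=
  prodLift_comp_self_eq_neg_nsmul hψ (neg_comp_neg_eq hψ)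

/-- **`ψ ≫ ψ = -1` on `S⁴`.** -/
theorem pad4Action_comp_self (hψ : ψ₀ ≫ ψ₀ = -(1 • 𝟙 E₀)) :
    pad4Action E₀ ψ₀ ≫ pad4Action E₀ ψ₀ = -(1 • 𝟙 (pad4Anchor E₀)) := by
  have hS := weilSurfAct_comp_self hψ
  have h2 : pad2Action E₀ ψ₀ ≫ pad2Action E₀ ψ₀ = -(1 • 𝟙 (pad2Anchor E₀)) :=
    prodLift_comp_self_eq_neg_nsmul hS hS
  have h3 : pad3Action E₀ ψ₀ ≫ pad3Action E₀ ψ₀ = -(1 • 𝟙 (pad3Anchor E₀)) :=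
    prodLift_comp_self_eq_neg_nsmul h2 hS
  exact prodLift_comp_self_eq_neg_nsmul h3 hS

end Anchor

/-! ## §1 The carrier truncation (sub-rung vocabulary) -/

/-- **An integral lci CARRIER of `q·hⁿ + w` on `P`** = `HasBlochSeedAt n P h w` with the Bloch-semiregularity clause
DELETED (all other conjuncts verbatim).  Sub-rung vocabulary only; NOT a witness of the lever by itself. -/
def HasLciCarrierAt (n : ℕ) (P : AbelianVariety ℂ) (h : complexBetti P.X 2) (w : complexBetti P.X (2 * n)) : Prop :=
  ∃ (Z : Scheme.{0}) (i : Z ⟶ P.X.left) (q : ℚ),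
    IsClosedImmersion i ∧ IsRegularImmersionOfCodim i n ∧ AlgebraicGeometry.IsIntegral Z ∧
    (∀ z ∈ Set.range i.base, (n : ℕ∞) ≤ Order.coheight z) ∧
    ((q : ℚ) : ℂ) • cupPowTwo h n + w ∈ classesSupportedOn P.X (Set.range i.base) (2 * n)

/-- A Bloch seed is in particular an lci carrier (delete one conjunct). -/
theorem hasLciCarrierAt_of_hasBlochSeedAt {n : ℕ} {P : AbelianVariety ℂ} {h : complexBetti P.X 2}
    {w : complexBetti P.X (2 * n)} (hS : HasBlochSeedAt n P h w) : HasLciCarrierAt n P h w := by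
  obtain ⟨Z, i, q, hi, hreg, hint, hcoh, -, hsupp⟩ := hS
  exact ⟨Z, i, q, hi, hreg, hint, hcoh, hsupp⟩

/-! ## §2 Registered stubs -/

/-- **STUB R — THE RUNG (BC5 / T3 plan-only) and THE BET: a hyperbolic Bloch seed with non-zero `ℚ(i)`-Weil part ON THE
NAMED PAD-4 ANCHOR `S⁴(E₀)`.**  Technique: PAD-4 `(7,3)` two-level ⊕-block zero locus `Z(s)`, `[Z(s)] = c₄(𝓔) = q·h⁴ + w_μ`
(`μ ≠ 0`), regular section ⇒ lci, Fulton–Lazarsfeld ⇒ integral, certified `σ`-injectivity (`s4tan_A.py` v2 → full Bloch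
map) ⇒ `IsBlochSemiregular`, for `h_K = 6·h_std` of the embedding by `3·h_std`.  See the module docstring for why it might
fail. [cite: Bloch1972Semiregularity, Remark (7.5)] [cite: Fulton1998IntersectionTheory, Ex. 14.1.1] -/
theorem stub_rung_pad4_seedAt (E₀ : AbelianVariety ℂ) (ψ₀ : E₀ ⟶ E₀) (hE : E₀.dim = 1)
    (hψ : ψ₀ ≫ ψ₀ = -(1 • 𝟙 E₀)) :
    ∃ (e : ProjectiveEmbedding (pad4Anchor E₀).X) (a : complexBetti (projectiveSpace e.n ℂ) 2)
      (w : complexBetti (pad4Anchor E₀).X (2 * 4)),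
      IsRationalClass a ∧ a ≠ 0 ∧
      IsHyperbolicWeilType (pad4Anchor E₀) (pad4Action E₀ ψ₀) 4 (symH (pad4Action E₀ ψ₀) e a) ∧
      w ∈ weilClassesOf (pad4Anchor E₀) (pad4Action E₀ ψ₀) 4 1 ∧ IsRationalClass w ∧ w ≠ 0 ∧
      HasBlochSeedAt 4 (pad4Anchor E₀) (symH (pad4Action E₀ ψ₀) e a) w := by
  sorry

/-- **STUB C — SUB-RUNG (the `(A1)` half; strictly weaker than STUB R, see `pad4_carrier_of_seedAt`): an integral lci
fourfold on the named anchor `S⁴(E₀)` carrying `q·h_K⁴ + w` with `w ≠ 0` rational in the `ℚ(i)`-Weil plane.**  Technique: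
the class/carrier half of the PAD-4 line (e-word-feasible `(7,3)` design made rational and positive; `[Z(s)] = c₄`;
Fulton–Lazarsfeld).  Open on its own (every carrier built so far has Weil part `0`); NOT a T3 witness (no semiregularity
clause). [cite: Fulton1998IntersectionTheory, Ex. 14.1.1 and §14.4] -/
theorem stub_pad4_carrier (E₀ : AbelianVariety ℂ) (ψ₀ : E₀ ⟶ E₀) (hE : E₀.dim = 1)
    (hψ : ψ₀ ≫ ψ₀ = -(1 • 𝟙 E₀)) :
    ∃ (e : ProjectiveEmbedding (pad4Anchor E₀).X) (a : complexBetti (projectiveSpace e.n ℂ) 2)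
      (w : complexBetti (pad4Anchor E₀).X (2 * 4)),
      IsRationalClass a ∧ a ≠ 0 ∧
      w ∈ weilClassesOf (pad4Anchor E₀) (pad4Action E₀ ψ₀) 4 1 ∧ IsRationalClass w ∧ w ≠ 0 ∧
      HasLciCarrierAt 4 (pad4Anchor E₀) (symH (pad4Action E₀ ψ₀) e a) w := by
  sorry

/-! ## §3 The ladder and the composition (no sorry below) -/

/-- The rung implies the sub-rung, statementwise (so STUB C is ON PATH: crux-at-anchor ⟹ carrier-at-anchor). -/
theorem pad4_carrier_of_seedAt (E₀ : AbelianVariety ℂ) (ψ₀ : E₀ ⟶ E₀)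
    (hR : ∃ (e : ProjectiveEmbedding (pad4Anchor E₀).X) (a : complexBetti (projectiveSpace e.n ℂ) 2)
      (w : complexBetti (pad4Anchor E₀).X (2 * 4)),
      IsRationalClass a ∧ a ≠ 0 ∧
      IsHyperbolicWeilType (pad4Anchor E₀) (pad4Action E₀ ψ₀) 4 (symH (pad4Action E₀ ψ₀) e a) ∧
      w ∈ weilClassesOf (pad4Anchor E₀) (pad4Action E₀ ψ₀) 4 1 ∧ IsRationalClass w ∧ w ≠ 0 ∧
      HasBlochSeedAt 4 (pad4Anchor E₀) (symH (pad4Action E₀ ψ₀) e a) w) :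
    ∃ (e : ProjectiveEmbedding (pad4Anchor E₀).X) (a : complexBetti (projectiveSpace e.n ℂ) 2)
      (w : complexBetti (pad4Anchor E₀).X (2 * 4)),
      IsRationalClass a ∧ a ≠ 0 ∧
      w ∈ weilClassesOf (pad4Anchor E₀) (pad4Action E₀ ψ₀) 4 1 ∧ IsRationalClass w ∧ w ≠ 0 ∧
      HasLciCarrierAt 4 (pad4Anchor E₀) (symH (pad4Action E₀ ψ₀) e a) w := by
  obtain ⟨e, a, w, ha, ha0, -, hwW, hwr, hw0, hseed⟩ := hR
  exact ⟨e, a, w, ha, ha0, hwW, hwr, hw0, hasLciCarrierAt_of_hasBlochSeedAt hseed⟩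

/-- **The crux PINNED to the anchor implies the crux**: `HasHyperbolicBlochSeed 4 1` from STUB R, the CM curve `E_i`
(`exists_cmCurve_sqrt_neg 1`), `dim S⁴ = 8` and `ψ² = -1` (proved above).  Concludes
`Summit.HodgeConjecture.HodgeConjecture.Theses.EightfoldBlochSeeds.BlochSeedDiscOne` BY NAME. -/
theorem BlochSeedDiscOne_of_pad4 : Summit.HodgeConjecture.HodgeConjecture.Theses.EightfoldBlochSeeds.BlochSeedDiscOne := by
  obtain ⟨E₀, ψ₀, hE, hψ⟩ :=
    Literature.NumberTheory.EllipticCurves.CMEndomorphism.exists_cmCurve_sqrt_neg 1 one_pos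
  obtain ⟨e, a, w, ha, ha0, hhyp, hwW, hwr, hw0, hseed⟩ := stub_rung_pad4_seedAt E₀ ψ₀ hE hψ
  exact ⟨pad4Anchor E₀, pad4Action E₀ ψ₀, e, a, w, pad4Anchor_dim hE, pad4Action_comp_self hψ, ha, ha0, hhyp,
    hwW, hwr, hw0, hseed⟩

end Summit.HodgeConjecture.HodgeConjecture.Cruxes.BlochSeedDiscOne.Birth

end
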